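import Summits.Ventures.HSemireg.Pad4TowerLineDesignCert12RuleD1
import Summits.Ventures.HSemireg.Pad4TowerLineDesignCert12RuleD2
import Summits.Ventures.HSemireg.Pad4TowerLineDesignCert12RuleD3
import Summits.Ventures.HSemireg.Pad4TowerLineDesignCert12XPlus1
import Summits.Ventures.HSemireg.Pad4TowerLineDesignCert12XPlus2
import Summits.Ventures.HSemireg.Pad4TowerLineDesignCert12XPlus3
import Summits.Ventures.HSemireg.Pad4TowerLineDesignCert12XPlus4

/-!
# Pad4Tower ∕ LineDesignCert12 — KERNEL CERTIFICATE (tree cut, ONE theorem): an explicit ODD H₁-static G₁-closed first-order design at height 12 on the ceiling line ⇒ `¬ SeedB1OddDiamondG1H1 12`, `¬ SeedB1OddConeG1H1`, `¬ SeedB1OddDiamondG1H1 h'` (12 ≤ h') UNCONDITIONALLY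

HONEST FRAMING. Lens seat `plan-lens-HodgeAV-negation` (LINE 6 «ceiling-line game»; director-hodge req-36 ∕ R19.2 ∕ R19.27 ∕ R19.34 ∕ R19.59 ∕ R19.82), crux of record
stmt-HodgeConjecture-18881 `BlochSeedDiscOne` (skeleton `Cruxes∕BlochSeedDiscOne∕Lines∕birth.lean` 814a6a70c14e831a UNTOUCHED). This module ASSEMBLES the kernel
certificate `Cert12` — farm-certified 2026-08-29 in FIVE PARTS over byte-identical literals (`Cruxes∕BlochSeedDiscOne` workfiles `CeilingLineCert12A–E`,
each rc 0 `decide +kernel` ∕ std axioms ∕ `Elab.async false` ∕ ≤ 1 800 s; director-hodge WORDS (B′) R19.82: «refuted PART-WISE in the kernel with textual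
assembly») — into ONE TREE THEOREM: the six named hypotheses of part A's doors (`hDN_B hDP_B hDP_C hX_C hX_D hX_E`) are here the theorems `ruleDN_B`,
`ruleDP_B`, `ruleDP_C`, `xplus_C`, `xplus_D`, `xplus_E` assembled from the `RuleD` ∕ `XPlus` modules' chunk decides, so the doors are UNCONDITIONAL:
**`not_seedB1OddDiamondG1H1 : ¬ SeedB1OddDiamondG1H1 12`** ((T₁₂) of `Pad4TowerB1OddSpanControl` is FALSE), **`not_seedB1OddConeG1H1 : ¬ SeedB1OddConeG1H1`**
((T_∞) FALSE), **`not_seedB1OddDiamondG1H1_ge : 12 ≤ h' → ¬ SeedB1OddDiamondG1H1 h'`**, and the LINE shape `oddLineDesign_shape` (= LINE 6's `¬ SeedB1OddLine 12`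
unfolded; Cruxes modules are not importable, so it is stated by shape). READING (director's words, unchanged): the H₁-STATIC ODD-SEED EXCLUSION TOWER (T_h) is
REFUTED FROM HEIGHT 12 ON — a statement about the typed first-order static game only; (T₈)∕(T₁₀) («no odd H₁-static G₁-closed design at ◇₈ ∕ ◇₁₀») remain
MACHINE ×2 (census W16∕W22 …) and are untouched here; s_odd ≤ 12.

WHAT IS CERTIFIED (all kernel): `cfg.InDiamond 12` · every letter on `α + c = 12` · `cfg.G1Closed` (`…Cert12Closure`) · `RuleDMu4Closed cfg` (304 `N`-heads +
464 `P`-heads, `…Cert12RuleD1–3`) · `XPlusClosed cfg` (through the literal dual `cfgd = cfg.dual 0` and the guarded form `xresXClosed_iff_guarded'`, 464 dual heads,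
`…Cert12XPlus1–4`) · `A2IMinusClosed cfg` (by the LINE LEMMA `a2iMinusClosed_of_onCeiling`: A2I⁻ is vacuous on a line support inside a diamond — no decide) ⇒
**`cfg_staticH1 : cfg.StaticH1`**; `cfg.HasOddFC`; plus `CellRealisable 12` for every cell of the support (LINE 6 ∕ anomaly census objects).

PROVENANCE (one machine step, irrelevant to validity — the theorems hold for the lists AS WRITTEN): s4-search-1 g28's (S2) minimisation kit j326935
«WLINE-S2-MIN12» of the LINE-12 odd-FC instance (kit j326579 ∕ j326707) ⇒ `model-res-L12min-best.cells.json` sha16 1beef026ebdf95b9 (19 G₁-orbits, 768 cells: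
304 `N` + 464 `P`; one odd fully-charged orbit `P[8I+2ℓ₋₁|10I+ℓ_i|10I+ℓ_i|10I+ℓ_i]`); replays of record: g28 full-◇₁₂ (a) 0 violations, control g4 typed replay (b)
0 ∕ 0 ∕ 0 + HasOddFC, idea-crit-6 g8 price (bus l.35064); coordinates transcribed VERBATIM from the json's `(α, Re β, Im β)` triples (`mcellOf …`), sorted by
`key`, chunked 5 `N` ∕ 10 `P` ∕ 6 dual heads per literal — generator `make_tree12.py` (negation g7) = split5 `make_cert5.py` (negation g6) with tree file
boundaries; the 187 chunk literals are BYTE-IDENTICAL to the five farm-certified Cruxes-level parts `CeilingLineCert12A–E` (668d9816f56ebca8, 263ede3fdab45507,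
2388ae7fca77709f, 5710c290867c27ec, c203a45ea54cbc5b; director-hodge R19.82 WORDS (B′)): literal block R2 sha16 12ca3aa4f0af6f59 = `litblock.py` re-hash of the
data modules concatenated in the order DataN, DataP, DataPd, DataNd.

MODULE SET (tree cut of ONE certificate; one namespace `Summit.Ventures.HSemireg.Pad4Tower.LineDesignCert12`): `…Cert12DataN` ∕ `DataP` ∕ `DataPd` ∕ `DataNd` (the support and its literal
dual-0 world, DATA ONLY) → `…Cert12Closure` (key-chain `Nodup`, the design `cfg`, the literal dual `cfgd` and `cfg_dual_eq`, ◇₁₂, the ceiling line, per-chunk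
G₁ closure ⇒ `cfg` is Δ- and S₄-closed) → `…Cert12RuleD1` ∕ `…Cert12RuleD2` ∕ `…Cert12RuleD3` ∕ `…Cert12XPlus1` ∕ `…Cert12XPlus2` ∕ `…Cert12XPlus3` ∕ `…Cert12XPlus4` (the RULE D (μ₄, M) resp. guarded X⁺
decides, a few heads per theorem, module boundaries set by the gate's build budget only) → `Pad4TowerLineDesignCert12` (assembly `cfg_staticH1` and the
UNCONDITIONAL doors `¬ SeedB1OddDiamondG1H1 12`, `¬ SeedB1OddConeG1H1`, `¬ SeedB1OddDiamondG1H1 h'` (12 ≤ h'), the LINE shape, every support cell's realisability).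

NOTHING IN THIS MODULE SET SAYS THAT HC ∕ HC_CM ∕ HC_AV ∕ H2 ∕ stmt-HodgeConjecture-18881 HOLDS OR FAILS (HC_CM is a displayed binder of the
ladder only); the certified statements concern the typed FIRST-ORDER static game (`RuleDMu4Closed`, `XPlusClosed`, `A2IMinusClosed` = `MConfig.StaticH1`)
of ONE explicit finite support — first order is necessary, not sufficient, for a seed; no σ, no seed, no census row. `decide +kernel` only: NO `native_decide`,
no `sorry`, no `axiom`, no `instance`, no notation, no Literature fact, no new `def … : Prop`.
-/

set_option linter.dupNamespace false

namespace Summit.Ventures.HSemireg.Pad4Tower.LineDesignCert12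

open Summit.Ventures.HSemireg Summit.Ventures.HSemireg.Pad4Tower

set_option maxRecDepth 32768
set_option Elab.async false
set_option synthInstance.maxSize 8192
set_option synthInstance.maxHeartbeats 2000000
set_option maxHeartbeats 8000000

/-! ## §1 Generic reductions (logic only) -/

/-- the `X` family in GUARDED form: apex, partner and sibling guards hoisted (same statement; `XresXFires` begins with `¬ isApex (Z σ)`). -/
theorem xresXClosed_iff_guarded' (D : MConfig) : XresXClosed D ↔
    ∀ Z ∈ D.lower, ∀ σ : Fin 4, ¬ isApex (Z σ) → ∀ u : Fin 4, ∀ q ∈ D.upper, UPartner Z q σ u → ∀ w : Fin 4, ∀ n ∈ D.lower,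
      Sibling q n σ w → ∀ f : Fin 4, ¬ XresXFires D Z q n σ u w f := by
  constructor
  · intro h Z hZ σ _ u q hq _ w n hn _ f
    exact h Z hZ q hq n hn σ u w f
  · intro h Z hZ q hq n hn σ u w f hF
    exact h Z hZ σ hF.1 u q hq hF.2.2.1 w n hn hF.2.2.2.2.2.1 f hF

/-- the four unit phase steps, as values of the two direction tables of `ray`. -/
theorem stepVals (k : Fin 4) :
    (![(1:ℤ), 0, -1, 0] k = 1 ∧ ![(0:ℤ), -1, 0, 1] k = 0) ∨ (![(1:ℤ), 0, -1, 0] k = 0 ∧ ![(0:ℤ), -1, 0, 1] k = -1) ∨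
      (![(1:ℤ), 0, -1, 0] k = -1 ∧ ![(0:ℤ), -1, 0, 1] k = 0) ∨ (![(1:ℤ), 0, -1, 0] k = 0 ∧ ![(0:ℤ), -1, 0, 1] k = 1) := by
  fin_cases k <;> decide

/-- **`A2I⁻` IS VACUOUS ON A LINE SUPPORT** (general; = s4-search-1's «A2I⁻ instances 0 ∕ G-L2 = 0 on the LINE alphabet» as a theorem).
If `C ⊂ ◇_h` and every letter of every cell of both levels lies on the ceiling line `α + c = h`, the `A2I` family has NO instance on `C`:
an instance needs `EncDir (Z σ) u ∧ UPartner Z q σ u` with `q ∈ C.upper`, i.e. `q σ = Z σ − e·(1, n_u)` DOWN `Z σ`'s own ray, `e ≥ 1`,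
of causal height `(α − e) + |c − e| < α + c = h` since `c ≥ 1` (`¬ isApex (Z σ)`) and `α ≥ 0` in the diamond — off the line. (In the dual
world `α < 0` and the partner runs UP the line, so `A2I⁺` is NOT vacuous there; only `A2I⁻` is.) -/
theorem a2iMinusClosed_of_onCeiling (C : MConfig) (h : ℤ) (hD : C.InDiamond h)
    (hN : ∀ Z ∈ C.lower, ∀ f, OnCeiling h (Z f)) (hP : ∀ P ∈ C.upper, ∀ f, OnCeiling h (P f)) :
    A2IMinusClosed C := by
  intro Z hZ q hq N' _ σ u f' v hF
  have hα : 0 ≤ (Z σ).1 := (inDiamond_bounds (hD.1 Z hZ σ)).1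
  have hapex : ¬ isApex (Z σ) := hF.1
  have henc : EncDir (Z σ) u := hF.2.1
  have hup : (q σ).1 < (Z σ).1 ∧ Z σ = ray (q σ) u ((Z σ).1 - (q σ).1) := ⟨hF.2.2.1.2.1, hF.2.2.1.2.2⟩
  have hzl : OnCeiling h (Z σ) := hN Z hZ σ
  have hql : OnCeiling h (q σ) := hP q hq σ
  clear hF
  generalize hx : Z σ = x at hapex henc hup hzl hα
  generalize hy : q σ = y at hup hql
  obtain ⟨α, b1, b2⟩ := x
  obtain ⟨α', b1', b2'⟩ := y
  simp only [isApex, EncDir, OnCeiling, absCharge, chargeOf, cabs, ray, Prod.mk.injEq, not_and] at hapex henc hup hzl hql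
  have m1 := le_max_left |b1| |b2|
  have m2 := le_max_right |b1| |b2|
  rcases abs_cases b1 with ⟨a1, _⟩ | ⟨a1, _⟩ <;> rcases abs_cases b2 with ⟨a2, _⟩ | ⟨a2, _⟩ <;>
    rcases abs_cases (b1 - b2) with ⟨a3, _⟩ | ⟨a3, _⟩ <;> rcases abs_cases (b1' - b2') with ⟨a4, _⟩ | ⟨a4, _⟩ <;>
    rcases stepVals u with ⟨d1, d2⟩ | ⟨d1, d2⟩ | ⟨d1, d2⟩ | ⟨d1, d2⟩ <;>
    simp only [d1, d2, mul_one, mul_zero, mul_neg, add_zero, zero_add] at henc hup <;> omega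

/-! ## §4 Assembly — the five parts' pieces, now theorems of the `RuleD` ∕ `XPlus` modules, recombined along the list spines -/

/-- **PART A's piece, level `N` (chunks 1–31)** — a theorem of part A of the five-part farm certificate; here the conjunction of the chunk theorems along the list spine. -/
theorem ruleDN_A : ∀ Z ∈ lN_A, RuleDMu4N cfg Z := List.forall_mem_append.2 ⟨List.forall_mem_append.2 ⟨List.forall_mem_append.2 ⟨List.forall_mem_append.2 ⟨List.forall_mem_append.2 ⟨List.forall_mem_append.2 ⟨List.forall_mem_append.2 ⟨List.forall_mem_append.2 ⟨List.forall_mem_append.2 ⟨List.forall_mem_append.2 ⟨List.forall_mem_append.2 ⟨List.forall_mem_append.2 ⟨List.forall_mem_append.2 ⟨List.forall_mem_append.2 ⟨List.forall_mem_append.2 ⟨List.forall_mem_append.2 ⟨List.forall_mem_append.2 ⟨List.forall_mem_append.2 ⟨List.forall_mem_append.2 ⟨List.forall_mem_append.2 ⟨List.forall_mem_append.2 ⟨List.forall_mem_append.2 ⟨List.forall_mem_append.2 ⟨List.forall_mem_append.2 ⟨List.forall_mem_append.2 ⟨List.forall_mem_append.2 ⟨List.forall_mem_append.2 ⟨List.forall_mem_append.2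 ⟨List.forall_mem_append.2 ⟨List.forall_mem_append.2 ⟨ruleDN_1, ruleDN_2⟩, ruleDN_3⟩, ruleDN_4⟩, ruleDN_5⟩, ruleDN_6⟩, ruleDN_7⟩, ruleDN_8⟩, ruleDN_9⟩, ruleDN_10⟩, ruleDN_11⟩, ruleDN_12⟩, ruleDN_13⟩, ruleDN_14⟩, ruleDN_15⟩, ruleDN_16⟩, ruleDN_17⟩, ruleDN_18⟩, ruleDN_19⟩, ruleDN_20⟩, ruleDN_21⟩, ruleDN_22⟩, ruleDN_23⟩, ruleDN_24⟩, ruleDN_25⟩, ruleDN_26⟩, ruleDN_27⟩, ruleDN_28⟩, ruleDN_29⟩, ruleDN_30⟩, ruleDN_31⟩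
/-- **PART B's piece, level `N` (chunks 32–61)** — a theorem of part B of the five-part farm certificate and a NAMED HYPOTHESIS of part A's doors; here the conjunction of the chunk theorems along the list spine. -/
theorem ruleDN_B : ∀ Z ∈ lN_B, RuleDMu4N cfg Z := List.forall_mem_append.2 ⟨List.forall_mem_append.2 ⟨List.forall_mem_append.2 ⟨List.forall_mem_append.2 ⟨List.forall_mem_append.2 ⟨List.forall_mem_append.2 ⟨List.forall_mem_append.2 ⟨List.forall_mem_append.2 ⟨List.forall_mem_append.2 ⟨List.forall_mem_append.2 ⟨List.forall_mem_append.2 ⟨List.forall_mem_append.2 ⟨List.forall_mem_append.2 ⟨List.forall_mem_append.2 ⟨List.forall_mem_append.2 ⟨List.forall_mem_append.2 ⟨List.forall_mem_append.2 ⟨List.forall_mem_append.2 ⟨List.forall_mem_append.2 ⟨List.forall_mem_append.2 ⟨List.forall_mem_append.2 ⟨List.forall_mem_append.2 ⟨List.forall_mem_append.2 ⟨List.forall_mem_append.2 ⟨List.forall_mem_append.2 ⟨List.forall_mem_append.2 ⟨List.forall_mem_append.2 ⟨List.forall_mem_append.2 ⟨List.forall_mem_append.2 ⟨ruleDN_32,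 ruleDN_33⟩, ruleDN_34⟩, ruleDN_35⟩, ruleDN_36⟩, ruleDN_37⟩, ruleDN_38⟩, ruleDN_39⟩, ruleDN_40⟩, ruleDN_41⟩, ruleDN_42⟩, ruleDN_43⟩, ruleDN_44⟩, ruleDN_45⟩, ruleDN_46⟩, ruleDN_47⟩, ruleDN_48⟩, ruleDN_49⟩, ruleDN_50⟩, ruleDN_51⟩, ruleDN_52⟩, ruleDN_53⟩, ruleDN_54⟩, ruleDN_55⟩, ruleDN_56⟩, ruleDN_57⟩, ruleDN_58⟩, ruleDN_59⟩, ruleDN_60⟩, ruleDN_61⟩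
/-- **PART B's piece, level `P` (chunks 1–20)** — a theorem of part B of the five-part farm certificate and a NAMED HYPOTHESIS of part A's doors; here the conjunction of the chunk theorems along the list spine. -/
theorem ruleDP_B : ∀ P ∈ lP_B, RuleDMu4P cfg P := List.forall_mem_append.2 ⟨List.forall_mem_append.2 ⟨List.forall_mem_append.2 ⟨List.forall_mem_append.2 ⟨List.forall_mem_append.2 ⟨List.forall_mem_append.2 ⟨List.forall_mem_append.2 ⟨List.forall_mem_append.2 ⟨List.forall_mem_append.2 ⟨List.forall_mem_append.2 ⟨List.forall_mem_append.2 ⟨List.forall_mem_append.2 ⟨List.forall_mem_append.2 ⟨List.forall_mem_append.2 ⟨List.forall_mem_append.2 ⟨List.forall_mem_append.2 ⟨List.forall_mem_append.2 ⟨List.forall_mem_append.2 ⟨List.forall_mem_append.2 ⟨ruleDP_1, ruleDP_2⟩, ruleDP_3⟩, ruleDP_4⟩, ruleDP_5⟩, ruleDP_6⟩, ruleDP_7⟩, ruleDP_8⟩, ruleDP_9⟩, ruleDP_10⟩, ruleDP_11⟩, ruleDP_12⟩, ruleDP_13⟩, ruleDP_14⟩, ruleDP_15⟩, ruleDP_16⟩,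 ruleDP_17⟩, ruleDP_18⟩, ruleDP_19⟩, ruleDP_20⟩
/-- **PART C's piece, level `P` (chunks 21–47)** — a theorem of part C of the five-part farm certificate and a NAMED HYPOTHESIS of part A's doors; here the conjunction of the chunk theorems along the list spine. -/
theorem ruleDP_C : ∀ P ∈ lP_C, RuleDMu4P cfg P := List.forall_mem_append.2 ⟨List.forall_mem_append.2 ⟨List.forall_mem_append.2 ⟨List.forall_mem_append.2 ⟨List.forall_mem_append.2 ⟨List.forall_mem_append.2 ⟨List.forall_mem_append.2 ⟨List.forall_mem_append.2 ⟨List.forall_mem_append.2 ⟨List.forall_mem_append.2 ⟨List.forall_mem_append.2 ⟨List.forall_mem_append.2 ⟨List.forall_mem_append.2 ⟨List.forall_mem_append.2 ⟨List.forall_mem_append.2 ⟨List.forall_mem_append.2 ⟨List.forall_mem_append.2 ⟨List.forall_mem_append.2 ⟨List.forall_mem_append.2 ⟨List.forall_mem_append.2 ⟨List.forall_mem_append.2 ⟨List.forall_mem_append.2 ⟨List.forall_mem_append.2 ⟨List.forall_mem_append.2 ⟨List.forall_mem_append.2 ⟨List.forall_mem_append.2 ⟨ruleDP_21, ruleDP_22⟩,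 ruleDP_23⟩, ruleDP_24⟩, ruleDP_25⟩, ruleDP_26⟩, ruleDP_27⟩, ruleDP_28⟩, ruleDP_29⟩, ruleDP_30⟩, ruleDP_31⟩, ruleDP_32⟩, ruleDP_33⟩, ruleDP_34⟩, ruleDP_35⟩, ruleDP_36⟩, ruleDP_37⟩, ruleDP_38⟩, ruleDP_39⟩, ruleDP_40⟩, ruleDP_41⟩, ruleDP_42⟩, ruleDP_43⟩, ruleDP_44⟩, ruleDP_45⟩, ruleDP_46⟩, ruleDP_47⟩
/-- **PART C's piece, level X⁺ (dual heads) (chunks 1–20)** — a theorem of part C of the five-part farm certificate and a NAMED HYPOTHESIS of part A's doors; here the conjunction of the chunk theorems along the list spine. -/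
theorem xplus_C : ∀ Z ∈ lPd_C, ∀ σ : Fin 4, ¬ isApex (Z σ) → ∀ u : Fin 4, ∀ q ∈ sNd, UPartner Z q σ u → ∀ w : Fin 4, ∀ n ∈ sPd,
    Sibling q n σ w → ∀ f : Fin 4, ¬ XresXFires cfgd Z q n σ u w f := List.forall_mem_append.2 ⟨List.forall_mem_append.2 ⟨List.forall_mem_append.2 ⟨List.forall_mem_append.2 ⟨List.forall_mem_append.2 ⟨List.forall_mem_append.2 ⟨List.forall_mem_append.2 ⟨List.forall_mem_append.2 ⟨List.forall_mem_append.2 ⟨List.forall_mem_append.2 ⟨List.forall_mem_append.2 ⟨List.forall_mem_append.2 ⟨List.forall_mem_append.2 ⟨List.forall_mem_append.2 ⟨List.forall_mem_append.2 ⟨List.forall_mem_append.2 ⟨List.forall_mem_append.2 ⟨List.forall_mem_append.2 ⟨List.forall_mem_append.2 ⟨xplus_1, xplus_2⟩, xplus_3⟩, xplus_4⟩, xplus_5⟩, xplus_6⟩, xplus_7⟩, xplus_8⟩, xplus_9⟩, xplus_10⟩, xplus_11⟩, xplus_12⟩, xplus_13⟩, xplus_14⟩, xplus_15⟩, xplus_16⟩,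 xplus_17⟩, xplus_18⟩, xplus_19⟩, xplus_20⟩
/-- **PART D's piece, level X⁺ (dual heads) (chunks 21–50)** — a theorem of part D of the five-part farm certificate and a NAMED HYPOTHESIS of part A's doors; here the conjunction of the chunk theorems along the list spine. -/
theorem xplus_D : ∀ Z ∈ lPd_D, ∀ σ : Fin 4, ¬ isApex (Z σ) → ∀ u : Fin 4, ∀ q ∈ sNd, UPartner Z q σ u → ∀ w : Fin 4, ∀ n ∈ sPd,
    Sibling q n σ w → ∀ f : Fin 4, ¬ XresXFires cfgd Z q n σ u w f := List.forall_mem_append.2 ⟨List.forall_mem_append.2 ⟨List.forall_mem_append.2 ⟨List.forall_mem_append.2 ⟨List.forall_mem_append.2 ⟨List.forall_mem_append.2 ⟨List.forall_mem_append.2 ⟨List.forall_mem_append.2 ⟨List.forall_mem_append.2 ⟨List.forall_mem_append.2 ⟨List.forall_mem_append.2 ⟨List.forall_mem_append.2 ⟨List.forall_mem_append.2 ⟨List.forall_mem_append.2 ⟨List.forall_mem_append.2 ⟨List.forall_mem_append.2 ⟨List.forall_mem_append.2 ⟨List.forall_mem_append.2 ⟨List.forall_mem_append.2 ⟨List.forall_mem_append.2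 ⟨List.forall_mem_append.2 ⟨List.forall_mem_append.2 ⟨List.forall_mem_append.2 ⟨List.forall_mem_append.2 ⟨List.forall_mem_append.2 ⟨List.forall_mem_append.2 ⟨List.forall_mem_append.2 ⟨List.forall_mem_append.2 ⟨List.forall_mem_append.2 ⟨xplus_21, xplus_22⟩, xplus_23⟩, xplus_24⟩, xplus_25⟩, xplus_26⟩, xplus_27⟩, xplus_28⟩, xplus_29⟩, xplus_30⟩, xplus_31⟩, xplus_32⟩, xplus_33⟩, xplus_34⟩, xplus_35⟩, xplus_36⟩, xplus_37⟩, xplus_38⟩, xplus_39⟩, xplus_40⟩, xplus_41⟩, xplus_42⟩, xplus_43⟩, xplus_44⟩, xplus_45⟩, xplus_46⟩, xplus_47⟩, xplus_48⟩, xplus_49⟩, xplus_50⟩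
/-- **PART E's piece, level X⁺ (dual heads) (chunks 51–78)** — a theorem of part E of the five-part farm certificate and a NAMED HYPOTHESIS of part A's doors; here the conjunction of the chunk theorems along the list spine. -/
theorem xplus_E : ∀ Z ∈ lPd_E, ∀ σ : Fin 4, ¬ isApex (Z σ) → ∀ u : Fin 4, ∀ q ∈ sNd, UPartner Z q σ u → ∀ w : Fin 4, ∀ n ∈ sPd,
    Sibling q n σ w → ∀ f : Fin 4, ¬ XresXFires cfgd Z q n σ u w f := List.forall_mem_append.2 ⟨List.forall_mem_append.2 ⟨List.forall_mem_append.2 ⟨List.forall_mem_append.2 ⟨List.forall_mem_append.2 ⟨List.forall_mem_append.2 ⟨List.forall_mem_append.2 ⟨List.forall_mem_append.2 ⟨List.forall_mem_append.2 ⟨List.forall_mem_append.2 ⟨List.forall_mem_append.2 ⟨List.forall_mem_append.2 ⟨List.forall_mem_append.2 ⟨List.forall_mem_append.2 ⟨List.forall_mem_append.2 ⟨List.forall_mem_append.2 ⟨List.forall_mem_append.2 ⟨List.forall_mem_append.2 ⟨List.forall_mem_append.2 ⟨List.forall_mem_append.2 ⟨List.forall_mem_append.2 ⟨List.forall_mem_append.2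 ⟨List.forall_mem_append.2 ⟨List.forall_mem_append.2 ⟨List.forall_mem_append.2 ⟨List.forall_mem_append.2 ⟨List.forall_mem_append.2 ⟨xplus_51, xplus_52⟩, xplus_53⟩, xplus_54⟩, xplus_55⟩, xplus_56⟩, xplus_57⟩, xplus_58⟩, xplus_59⟩, xplus_60⟩, xplus_61⟩, xplus_62⟩, xplus_63⟩, xplus_64⟩, xplus_65⟩, xplus_66⟩, xplus_67⟩, xplus_68⟩, xplus_69⟩, xplus_70⟩, xplus_71⟩, xplus_72⟩, xplus_73⟩, xplus_74⟩, xplus_75⟩, xplus_76⟩, xplus_77⟩, xplus_78⟩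
/-- RULE D at every `N`-cell (parts A, B). -/
theorem ruleDN_all : ∀ Z ∈ lN, RuleDMu4N cfg Z := List.forall_mem_append.2 ⟨ruleDN_A, ruleDN_B⟩
/-- RULE D at every `P`-cell (parts B, C). -/
theorem ruleDP_all : ∀ P ∈ lP, RuleDMu4P cfg P := List.forall_mem_append.2 ⟨ruleDP_B, ruleDP_C⟩
/-- **RULE D (μ₄, M) closed** — UNCONDITIONAL (all pieces are theorems of the `RuleD` modules). -/
theorem cfg_ruleDMu4Closed : RuleDMu4Closed cfg := ⟨fun Z hZ => ruleDN_all Z hZ, fun P hP => ruleDP_all P hP⟩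
/-- guarded X⁺ at every dual head (parts C, D, E). -/
theorem xplus_all : ∀ Z ∈ lPd, ∀ σ : Fin 4, ¬ isApex (Z σ) → ∀ u : Fin 4, ∀ q ∈ sNd, UPartner Z q σ u → ∀ w : Fin 4, ∀ n ∈ sPd,
    Sibling q n σ w → ∀ f : Fin 4, ¬ XresXFires cfgd Z q n σ u w f := List.forall_mem_append.2 ⟨List.forall_mem_append.2 ⟨xplus_C, xplus_D⟩, xplus_E⟩
/-- **X⁺ closed** — UNCONDITIONAL (the literal dual world `cfgd = cfg.dual 0` bridges by `cfg_dual_eq`). -/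
theorem cfg_xPlusClosed : XPlusClosed cfg := by
  have hx : XresXClosed cfgd := (xresXClosed_iff_guarded' cfgd).2 fun Z hZ => xplus_all Z hZ
  show XresXClosed (cfg.dual 0)
  rw [cfg_dual_eq]; exact hx
/-- **A2I⁻ closed** — by the LINE LEMMA `a2iMinusClosed_of_onCeiling` (no decide). -/
theorem cfg_a2iMinusClosed : A2IMinusClosed cfg := a2iMinusClosed_of_onCeiling cfg 12 cfg_inDiamond (fun Z hZ => lN_onLine Z hZ) (fun P hP => lP_onLine P hP)
/-- **THE DESIGN IS H₁-STATIC** — UNCONDITIONAL. -/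
theorem cfg_staticH1 : cfg.StaticH1 := ⟨cfg_ruleDMu4Closed, cfg_xPlusClosed, cfg_a2iMinusClosed⟩

/-! ## §5 Consequences (kernel, UNCONDITIONAL): the odd cell, the doors, the line shape -/

/-- the lists carry an odd fully-charged cell (the `P`-orbit of `P[8I+2ℓ₋₁|10I+ℓ_i|10I+ℓ_i|10I+ℓ_i]`). [kernel `decide`] -/
theorem cfg_oddFC_lists : (∃ Z ∈ lN, FCc Z ∧ OddPat Z.pat) ∨ (∃ P ∈ lP, FCc P ∧ OddPat P.pat) := by decide +kernel
/-- **THE SUPPORT CARRIES AN ODD FULLY-CHARGED CELL.** -/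
theorem cfg_hasOddFC : cfg.HasOddFC := cfg_oddFC_lists
/-- **(T_12) IS FALSE: `¬ SeedB1OddDiamondG1H1 12`** — an odd H₁-static G₁-closed first-order design in ◇_12 exists (tree-level negative word, UNCONDITIONAL). -/
theorem not_seedB1OddDiamondG1H1 : ¬ SeedB1OddDiamondG1H1 12 :=
  fun H => H cfg cfg_inDiamond cfg_g1Closed cfg_staticH1 cfg_hasOddFC
/-- **(T_∞) IS FALSE: `¬ SeedB1OddConeG1H1`** (via `inCone_of_inDiamond'`; UNCONDITIONAL). -/
theorem not_seedB1OddConeG1H1 : ¬ SeedB1OddConeG1H1 :=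
  fun H => H cfg (inCone_of_inDiamond' cfg_inDiamond) cfg_g1Closed cfg_staticH1 cfg_hasOddFC
/-- … hence `¬ SeedB1OddDiamondG1H1 h'` for every `h' ≥ 12` (antitone family; UNCONDITIONAL). -/
theorem not_seedB1OddDiamondG1H1_ge {h' : ℤ} (hh : 12 ≤ h') : ¬ SeedB1OddDiamondG1H1 h' :=
  fun H => not_seedB1OddDiamondG1H1 (seedB1OddDiamondG1H1_antitone hh H)
/-- the LINE shape (LINE 6 `¬ SeedB1OddLine 12`, unfolded; UNCONDITIONAL): an odd static G₁-closed ◇_12 support ON THE LINE. -/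
theorem oddLineDesign_shape : ∃ C : MConfig, C.InDiamond 12 ∧ ((∀ Z ∈ C.lower, ∀ f, OnCeiling 12 (Z f)) ∧ ∀ P ∈ C.upper, ∀ f, OnCeiling 12 (P f)) ∧
    C.G1Closed ∧ C.StaticH1 ∧ C.HasOddFC := ⟨cfg, cfg_inDiamond, cfg_onLine, cfg_g1Closed, cfg_staticH1, cfg_hasOddFC⟩
/-- every cell of the lower level is REALISABLE at ◇₁₂ (`Pad4TowerB1OddBoostBlind.CellRealisable 12 true`). -/
theorem lower_cellRealisable {Z : MCell} (hZ : Z ∈ lN) : CellRealisable 12 true Z := ⟨cfg, cfg_inDiamond, cfg_g1Closed, cfg_staticH1, by simpa using mem_lower_iff.mpr hZ⟩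
/-- every cell of the upper level is REALISABLE at ◇₁₂ (`Pad4TowerB1OddBoostBlind.CellRealisable 12 false`). -/
theorem upper_cellRealisable {P : MCell} (hP : P ∈ lP) : CellRealisable 12 false P := ⟨cfg, cfg_inDiamond, cfg_g1Closed, cfg_staticH1, by simpa using mem_upper_iff.mpr hP⟩

end Summit.Ventures.HSemireg.Pad4Tower.LineDesignCert12
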